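import Summits.AtomisticToContinuum.HydrodynamicLimit.Theorems.BoxDissipativeWeakStrongRelativeEnergyStabilityGronwallPathwiseA
import HarnessLib

/-!
# Crux `RelativeEnergyStability` (stmt-AtomisticToContinuum-17653), line `registered`, heart stub S-X — part 8b:
# the PATHWISE clamped relative-energy inequality (assembly)

`sx_pathwise`: along a good orbit with pairwise distinct velocities at rational times,
`e(t) − e(0) ≤ C ∫_{(0,t]} e(s) ds + |K1-defect(t)| + (K2-defect(t))⁺` — see part 8a
(`…GronwallPathwiseA`) for the decomposition, the piece identification and the integrated master inequality.
-/

noncomputable section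

namespace Summit.AtomisticToContinuum.HydrodynamicLimit.Theorems.RES

open MeasureTheory Filter Set Function
open scoped Topology InnerProductSpace ENNReal
open Summit.AtomisticToContinuum.HydrodynamicLimit.Theses.BoxDissipativeWeakStrong
open Literature.MathematicalPhysics.KineticTheory Literature.Analysis.FluidPDE Literature.Analysis.FunctionSpaces
open Literature.Analysis.FluidPDE.CompressibleEuler
open Literature.Analysis.FluidPDE.CompressibleEuler.EulerPhase
open Literature.Analysis.FluidPDE.CompressibleEuler.StrongPointData

section Pathwise

variable {η₀ η₁ η₁B σ T : ℝ} {F χ f : ℝ → ℝ} {ρ θ : ℝ → T3 → ℝ} {u : ℝ → T3 → V3}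

variable (S : AnalyticOnNhd ℝ F (Ioo (-η₀) η₀) ∧ EqOn hsExcessFreeEnergy F (Ico 0 η₀) ∧ 0 < η₁ ∧ η₁ ≤ η₁B ∧
  2 * η₁B < η₀ ∧ 0 < σ ∧
  (∀ x, 0 < x → x * σ ^ 3 ≤ η₁B → f x = hsExcessFreeEnergy (x * σ ^ 3) ∧ χ x = hsCompressibility (x * σ ^ 3)) ∧
  (EulerEOS.monatomicExcess χ f).IsGibbs ∧ IsHardSphereEulerSolution σ T ρ u θ ∧
  ∀ t ∈ Ico 0 T, ∀ x, ρ t x * σ ^ 3 ≤ η₁ / 2)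
include S

omit S in
/-- Continuity of the excess free energy on `[0, η₀)` from the EOS fact data. -/
theorem sx_continuousOn_hsExcess {η₀ : ℝ} {F : ℝ → ℝ} (hF : AnalyticOnNhd ℝ F (Ioo (-η₀) η₀))
    (hEq : EqOn hsExcessFreeEnergy F (Ico 0 η₀)) (hη₀ : 0 < η₀) : ContinuousOn hsExcessFreeEnergy (Ico 0 η₀) :=
  (hF.continuousOn.mono fun x hx => ⟨by linarith [hx.1], hx.2⟩).congr hEq

/-- **The pathwise clamped relative-energy inequality** (Březina–Feireisl §3.2 with zero defect, along one good orbit with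
pairwise distinct velocities at rational times): with `e(s) = clampedRelEnergyObs … s z`,
`e(t) − e(0) ≤ C ∫_{(0,t]} e(s) ds + |K1-defect(t)| + (K2-defect(t))⁺`, where the two defects are VERBATIM the pathwise
functionals of `sx_fluxClosure_velocity` / `sx_entropyAdmissibility_temperature` at `τ := t`, and `C` is a pointwise master
constant valid at vacuum / hot / small-frozen box states (`dens ≤ ρs`, `((N+1)ℓ³)⁻¹ ≤ ρs`). -/
theorem sx_pathwise (Φ : (N : ℕ) → HardSphereFlow (Literature.Analysis.FluidPDE.Torus.geometry (Fin 3)) (hsDiameter σ N) (N + 1))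
    (ℓ : ℕ → ℝ) (hℓ : ∀ N, 0 < ℓ N ∧ ℓ N ≤ 1) (N : ℕ) {z : Config (N + 1) (Fin 3) T3} (hz : z ∈ (Φ N).good)
    (hq : ∀ q : ℚ, ∀ i j, i ≠ j → ((Φ N).flow (q : ℝ) z i).2 ≠ ((Φ N).flow (q : ℝ) z j).2)
    (hBL : BoxBalanceLawsFor σ N (Φ N) (ℓ N) z) {a b : ℝ} (hab : a ≤ b) {t : ℝ} (ht : t ∈ Ico 0 T)
    {C ρs : ℝ} (hρs : ((N : ℝ) + 1)⁻¹ * (ℓ N ^ 3)⁻¹ ≤ ρs)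
    (hmaster : ∀ s ∈ Icc 0 t, ∀ (x : T3) (v : EulerPhase),
      (v = 0 ∨ (0 < dens v ∧ 0 < ien v) ∨ (0 < dens v ∧ ien v = 0 ∧ dens v ≤ ρs)) →
        reducedRHS (cutEOS σ η₁) (clamp a b) (pdAt T ρ u θ (s, x)) (dens v) (ien v) (mom v) ≤
          C * (pdAt T ρ u θ (s, x)).relEnergyZ (cutEOS σ η₁) (clamp a b) v) :
    clampedRelEnergyObs σ η₁ a b ρ u θ N (Φ N) (ℓ N) t z - clampedRelEnergyObs σ η₁ a b ρ u θ N (Φ N) (ℓ N) 0 z ≤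
      C * (∫ s in Ioc 0 t, clampedRelEnergyObs σ η₁ a b ρ u θ N (Φ N) (ℓ N) s z) +
        (|(∫ x, inner ℝ (boxState (ℓ N) ((Φ N).flow t z) x).2.1 (u t x)) -
                      (∫ x, inner ℝ (boxState (ℓ N) ((Φ N).flow 0 z) x).2.1 (u 0 x)) -
                      ∫ s in Ioc 0 t, ∫ x,
                        (inner ℝ (boxState (ℓ N) ((Φ N).flow s z) x).2.1
                            (Torus.timeDerivWithin (Ico 0 T) u s x) +
                          (∑ i, ∑ j, (boxState (ℓ N) ((Φ N).flow s z) x).2.1 i *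
                              (boxState (ℓ N) ((Φ N).flow s z) x).2.1 j /
                              (boxState (ℓ N) ((Φ N).flow s z) x).1 *
                            Torus.partialDeriv j (fun y => u s y i) x) +
                          (boxState (ℓ N) ((Φ N).flow s z) x).1 *
                              (2 / 3 * ((boxState (ℓ N) ((Φ N).flow s z) x).2.2 /
                                  (boxState (ℓ N) ((Φ N).flow s z) x).1 -
                                ‖(boxState (ℓ N) ((Φ N).flow s z) x).2.1‖ ^ 2 /
                                  (2 * (boxState (ℓ N) ((Φ N).flow s z) x).1 ^ 2))) *
                              cutCompressibility η₁ ((boxState (ℓ N) ((Φ N).flow s z) x).1 * σ ^ 3) *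
                            Torus.divergence (u s) x)|) +
        max ((∫ s in Ioc 0 t, ∫ x,
                        ((boxState (ℓ N) ((Φ N).flow s z) x).1 *
                              max a (min ((cutEOS σ η₁).s (boxState (ℓ N) ((Φ N).flow s z) x).1
                                (2 / 3 * ((boxState (ℓ N) ((Φ N).flow s z) x).2.2 /
                                    (boxState (ℓ N) ((Φ N).flow s z) x).1 -
                                  ‖(boxState (ℓ N) ((Φ N).flow s z) x).2.1‖ ^ 2 /
                                    (2 * (boxState (ℓ N) ((Φ N).flow s z) x).1 ^ 2)))) b) *
                            Torus.timeDerivWithin (Ico 0 T) θ s x +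
                          max a (min ((cutEOS σ η₁).s (boxState (ℓ N) ((Φ N).flow s z) x).1
                                (2 / 3 * ((boxState (ℓ N) ((Φ N).flow s z) x).2.2 /
                                    (boxState (ℓ N) ((Φ N).flow s z) x).1 -
                                  ‖(boxState (ℓ N) ((Φ N).flow s z) x).2.1‖ ^ 2 /
                                    (2 * (boxState (ℓ N) ((Φ N).flow s z) x).1 ^ 2)))) b) *
                            inner ℝ (boxState (ℓ N) ((Φ N).flow s z) x).2.1 (Torus.gradient (θ s) x))) -
                      (∫ x, (boxState (ℓ N) ((Φ N).flow t z) x).1 *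
                          max a (min ((cutEOS σ η₁).s (boxState (ℓ N) ((Φ N).flow t z) x).1
                            (2 / 3 * ((boxState (ℓ N) ((Φ N).flow t z) x).2.2 /
                                (boxState (ℓ N) ((Φ N).flow t z) x).1 -
                              ‖(boxState (ℓ N) ((Φ N).flow t z) x).2.1‖ ^ 2 /
                                (2 * (boxState (ℓ N) ((Φ N).flow t z) x).1 ^ 2)))) b) * θ t x) +
                      (∫ x, (boxState (ℓ N) ((Φ N).flow 0 z) x).1 *
                          max a (min ((cutEOS σ η₁).s (boxState (ℓ N) ((Φ N).flow 0 z) x).1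
                            (2 / 3 * ((boxState (ℓ N) ((Φ N).flow 0 z) x).2.2 /
                                (boxState (ℓ N) ((Φ N).flow 0 z) x).1 -
                              ‖(boxState (ℓ N) ((Φ N).flow 0 z) x).2.1‖ ^ 2 /
                                (2 * (boxState (ℓ N) ((Φ N).flow 0 z) x).1 ^ 2)))) b) * θ 0 x)) 0 := by
  have h0T : (0:ℝ) ∈ Ico 0 T := ⟨le_rfl, ht.1.trans_lt ht.2⟩
  have hl : 0 < ℓ N := (hℓ N).1
  have hη₀ : 0 < η₀ := S.2.2.1.trans (sx_band_lt S)
  have hsol := S.2.2.2.2.2.2.2.2.1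
  -- the four time-integrands and the observable, as functions of time
  set i₁ : ℝ → ℝ := fun s => ∫ x,
                        (inner ℝ (boxState (ℓ N) ((Φ N).flow s z) x).2.1
                            (Torus.timeDerivWithin (Ico 0 T) u s x) +
                          (∑ i, ∑ j, (boxState (ℓ N) ((Φ N).flow s z) x).2.1 i *
                              (boxState (ℓ N) ((Φ N).flow s z) x).2.1 j /
                              (boxState (ℓ N) ((Φ N).flow s z) x).1 *
                            Torus.partialDeriv j (fun y => u s y i) x) +
                          (boxState (ℓ N) ((Φ N).flow s z) x).1 *
                              (2 / 3 * ((boxState (ℓ N) ((Φ N).flow s z) x).2.2 /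
                                  (boxState (ℓ N) ((Φ N).flow s z) x).1 -
                                ‖(boxState (ℓ N) ((Φ N).flow s z) x).2.1‖ ^ 2 /
                                  (2 * (boxState (ℓ N) ((Φ N).flow s z) x).1 ^ 2))) *
                              cutCompressibility η₁ ((boxState (ℓ N) ((Φ N).flow s z) x).1 * σ ^ 3) *
                            Torus.divergence (u s) x) with hi₁
  set i₂ : ℝ → ℝ := fun s => ∫ x,
                        ((boxState (ℓ N) ((Φ N).flow s z) x).1 *
                              max a (min ((cutEOS σ η₁).s (boxState (ℓ N) ((Φ N).flow s z) x).1
                                (2 / 3 * ((boxState (ℓ N) ((Φ N).flow s z) x).2.2 /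
                                    (boxState (ℓ N) ((Φ N).flow s z) x).1 -
                                  ‖(boxState (ℓ N) ((Φ N).flow s z) x).2.1‖ ^ 2 /
                                    (2 * (boxState (ℓ N) ((Φ N).flow s z) x).1 ^ 2)))) b) *
                            Torus.timeDerivWithin (Ico 0 T) θ s x +
                          max a (min ((cutEOS σ η₁).s (boxState (ℓ N) ((Φ N).flow s z) x).1
                                (2 / 3 * ((boxState (ℓ N) ((Φ N).flow s z) x).2.2 /
                                    (boxState (ℓ N) ((Φ N).flow s z) x).1 -
                                  ‖(boxState (ℓ N) ((Φ N).flow s z) x).2.1‖ ^ 2 /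
                                    (2 * (boxState (ℓ N) ((Φ N).flow s z) x).1 ^ 2)))) b) *
                            inner ℝ (boxState (ℓ N) ((Φ N).flow s z) x).2.1 (Torus.gradient (θ s) x)) with hi₂
  set φ₁ := energyTestFunction (cutEOS σ η₁) ρ u θ with hφ₁
  set i₃ : ℝ → ℝ := fun s => ∫ x, ((boxState (ℓ N) ((Φ N).flow s z) x).1 * Torus.timeDerivWithin (Ico 0 T) φ₁ s x +
      inner ℝ (boxState (ℓ N) ((Φ N).flow s z) x).2.1 (Torus.gradient (φ₁ s) x)) with hi₃
  set i₅ : ℝ → ℝ := fun s => ∫ x, (pdAt T ρ u θ (s, x)).pt (cutEOS σ η₁) with hi₅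
  set e : ℝ → ℝ := fun s => clampedRelEnergyObs σ η₁ a b ρ u θ N (Φ N) (ℓ N) s z with he
  -- integrability in time
  have hK1 := FluxClosureB4.stub_boxIntegrableAlongFlow σ η₁ T Φ ℓ hℓ
  dsimp only at hK1
  have hI1 : IntegrableOn i₁ (Ioc 0 t) := (hK1 t ht u hsol.smooth_velocity N z hz).1
  have hI2 : IntegrableOn i₂ (Ioc 0 t) :=
    sx_integrableOn_ent (sx_continuousOn_hsExcess S.1 S.2.1 hη₀) S.2.2.2.2.2.1 S.2.2.1 (sx_band_lt S) hsol (Φ N) hl hz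
      hab ht
  obtain ⟨hI3, hE3⟩ := hBL.2.2.2 T φ₁ (sx_energyTest_smooth S) t ht
  obtain ⟨Np, hNp, hI5, -⟩ := sx_integrableOn_pt S ht
  obtain ⟨A, B, hobs⟩ := sx_integrableOn_obs S (Φ N) hl hab ht
  have hIe : IntegrableOn e (Ioc 0 t) := (hobs z hz).1
  -- exact pieces: energy, continuity, pressure
  have hE1t : (∫ x, (boxState (ℓ N) ((Φ N).flow t z) x).2.2) = ((N : ℝ) + 1)⁻¹ * configEnergy ((Φ N).flow t z) :=
    hBL.2.1 t
  have hE10 : (∫ x, (boxState (ℓ N) ((Φ N).flow 0 z) x).2.2) = ((N : ℝ) + 1)⁻¹ * configEnergy ((Φ N).flow 0 z) :=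
    hBL.2.1 0
  have hKEt := hBL.2.2.1 t
  have hKE0 := hBL.2.2.1 0
  have hE3' : (∫ x, (boxState (ℓ N) ((Φ N).flow t z) x).1 * φ₁ t x) -
      (∫ x, (boxState (ℓ N) ((Φ N).flow 0 z) x).1 * φ₁ 0 x) = ∫ s in Ioc 0 t, i₃ s := hE3
  have hE5 := sx_pressure_ftc S ht hNp
  -- decomposition of the observable at `t` and at `0`
  have hdt := sx_obs_decomp S (Φ N) (ℓ N) a b z ht
  have hd0 := sx_obs_decomp S (Φ N) (ℓ N) a b z h0T
  -- the combination of the four time integrals is `≤ C ∫ e`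
  have hpw : ∀ s ∈ Ioc 0 t, -i₁ s + i₃ s - i₂ s + i₅ s ≤ C * e s := by
    intro s hs
    have hs' : s ∈ Ico 0 T := ⟨hs.1.le, hs.2.trans_lt ht.2⟩
    have hdist := ad_distinct_of_rational (Φ N) hz hq s
    have h1 := (sx_pieces_eq_reduced S ((Φ N).flow s z) hdist hl a b hs').1
    have h2 := sx_reduced_integral_le S ((Φ N).flow s z) hdist hl hs' hρs (hmaster s ⟨hs.1.le, hs.2⟩)
    simp only [hi₁, hi₂, hi₃, hi₅, he, hφ₁, clampedRelEnergyObs]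
    rw [h1]
    exact h2
  have hI5' : IntegrableOn i₅ (Ioc 0 t) := hI5
  have hI3' : IntegrableOn i₃ (Ioc 0 t) := hI3
  have hI1n : IntegrableOn (fun s => -i₁ s) (Ioc 0 t) := hI1.neg
  have hA2 : IntegrableOn (fun s => -i₁ s + i₃ s) (Ioc 0 t) := hI1n.add hI3'
  have hA : IntegrableOn (fun s => -i₁ s + i₃ s - i₂ s) (Ioc 0 t) := hA2.sub hI2
  have hint : (∫ s in Ioc 0 t, (-i₁ s + i₃ s - i₂ s + i₅ s)) =
      -(∫ s in Ioc 0 t, i₁ s) + (∫ s in Ioc 0 t, i₃ s) - (∫ s in Ioc 0 t, i₂ s) + ∫ s in Ioc 0 t, i₅ s := by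
    have h1 := integral_add hA hI5'
    have h2 := integral_sub hA2 hI2
    have h3 := integral_add hI1n hI3'
    have h4 : (∫ s in Ioc 0 t, -i₁ s) = -∫ s in Ioc 0 t, i₁ s := integral_neg i₁
    linarith
  have hmono : (∫ s in Ioc 0 t, (-i₁ s + i₃ s - i₂ s + i₅ s)) ≤ ∫ s in Ioc 0 t, C * e s :=
    setIntegral_mono_on (hA.add hI5') (hIe.const_mul C) measurableSet_Ioc hpw
  rw [integral_const_mul] at hmono
  -- the two defects
  have hD1 : -((∫ x, inner ℝ (boxState (ℓ N) ((Φ N).flow t z) x).2.1 (u t x)) - (∫ x, inner ℝ (boxState (ℓ N) ((Φ N).flow 0 z) x).2.1 (u 0 x))) ≤ -(∫ s in Ioc 0 t, i₁ s) + |(∫ x, inner ℝ (boxState (ℓ N) ((Φ N).flow t z) x).2.1 (u t x)) - (∫ x, inner ℝ (boxState (ℓ N) ((Φ N).flow 0 z) x).2.1 (u 0 x)) - ∫ s in Ioc 0 t, i₁ s| := by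
    have := neg_le_abs ((∫ x, inner ℝ (boxState (ℓ N) ((Φ N).flow t z) x).2.1 (u t x)) - (∫ x, inner ℝ (boxState (ℓ N) ((Φ N).flow 0 z) x).2.1 (u 0 x)) - ∫ s in Ioc 0 t, i₁ s)
    linarith
  have hD2 : -((∫ x, (boxState (ℓ N) ((Φ N).flow t z) x).1 *
                          max a (min ((cutEOS σ η₁).s (boxState (ℓ N) ((Φ N).flow t z) x).1
                            (2 / 3 * ((boxState (ℓ N) ((Φ N).flow t z) x).2.2 /
                                (boxState (ℓ N) ((Φ N).flow t z) x).1 -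
                              ‖(boxState (ℓ N) ((Φ N).flow t z) x).2.1‖ ^ 2 /
                                (2 * (boxState (ℓ N) ((Φ N).flow t z) x).1 ^ 2)))) b) * θ t x) - (∫ x, (boxState (ℓ N) ((Φ N).flow 0 z) x).1 *
                          max a (min ((cutEOS σ η₁).s (boxState (ℓ N) ((Φ N).flow 0 z) x).1
                            (2 / 3 * ((boxState (ℓ N) ((Φ N).flow 0 z) x).2.2 /
                                (boxState (ℓ N) ((Φ N).flow 0 z) x).1 -
                              ‖(boxState (ℓ N) ((Φ N).flow 0 z) x).2.1‖ ^ 2 /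
                                (2 * (boxState (ℓ N) ((Φ N).flow 0 z) x).1 ^ 2)))) b) * θ 0 x)) ≤ -(∫ s in Ioc 0 t, i₂ s) + max ((∫ s in Ioc 0 t, i₂ s) - (∫ x, (boxState (ℓ N) ((Φ N).flow t z) x).1 *
                          max a (min ((cutEOS σ η₁).s (boxState (ℓ N) ((Φ N).flow t z) x).1
                            (2 / 3 * ((boxState (ℓ N) ((Φ N).flow t z) x).2.2 /
                                (boxState (ℓ N) ((Φ N).flow t z) x).1 -
                              ‖(boxState (ℓ N) ((Φ N).flow t z) x).2.1‖ ^ 2 /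
                                (2 * (boxState (ℓ N) ((Φ N).flow t z) x).1 ^ 2)))) b) * θ t x) + (∫ x, (boxState (ℓ N) ((Φ N).flow 0 z) x).1 *
                          max a (min ((cutEOS σ η₁).s (boxState (ℓ N) ((Φ N).flow 0 z) x).1
                            (2 / 3 * ((boxState (ℓ N) ((Φ N).flow 0 z) x).2.2 /
                                (boxState (ℓ N) ((Φ N).flow 0 z) x).1 -
                              ‖(boxState (ℓ N) ((Φ N).flow 0 z) x).2.1‖ ^ 2 /
                                (2 * (boxState (ℓ N) ((Φ N).flow 0 z) x).1 ^ 2)))) b) * θ 0 x)) 0 := by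
    have := le_max_left ((∫ s in Ioc 0 t, i₂ s) - (∫ x, (boxState (ℓ N) ((Φ N).flow t z) x).1 *
                          max a (min ((cutEOS σ η₁).s (boxState (ℓ N) ((Φ N).flow t z) x).1
                            (2 / 3 * ((boxState (ℓ N) ((Φ N).flow t z) x).2.2 /
                                (boxState (ℓ N) ((Φ N).flow t z) x).1 -
                              ‖(boxState (ℓ N) ((Φ N).flow t z) x).2.1‖ ^ 2 /
                                (2 * (boxState (ℓ N) ((Φ N).flow t z) x).1 ^ 2)))) b) * θ t x) + (∫ x, (boxState (ℓ N) ((Φ N).flow 0 z) x).1 *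
                          max a (min ((cutEOS σ η₁).s (boxState (ℓ N) ((Φ N).flow 0 z) x).1
                            (2 / 3 * ((boxState (ℓ N) ((Φ N).flow 0 z) x).2.2 /
                                (boxState (ℓ N) ((Φ N).flow 0 z) x).1 -
                              ‖(boxState (ℓ N) ((Φ N).flow 0 z) x).2.1‖ ^ 2 /
                                (2 * (boxState (ℓ N) ((Φ N).flow 0 z) x).1 ^ 2)))) b) * θ 0 x)) 0
    linarith
  -- assemble
  simp only [he] at hmono
  rw [hKEt] at hE1t
  rw [hKE0] at hE10
  linarith [hdt, hd0, hE1t, hE10, hE3', hE5, hint, hmono, hD1, hD2]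

end Pathwise

end Summit.AtomisticToContinuum.HydrodynamicLimit.Theorems.RES

end
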